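import Mathlib
import Summits.ValiantsHypothesis.ValiantsHypothesis.Theorems.BinomialElusiveBinomialCandidateExpoCongruence

/-!
# Crux `BinomialElusive.BinomialCandidate` (stmt-ValiantsHypothesis-7392), line `registered` —
# helper `expoCongruence_deg`: property (P2) of the exponent family with a general factor

The route's binomial curve at arity `m` has exponents
`E_m(j) = Σ_{k ≤ h} (j · M)^k`, with `h = ⌊log₂ m⌋²` and `M = (2m+2)^{h+1}`, for `1 ≤ j ≤ 2m`.
The landed stub `stub_expoCongruence` gives `2 · E_m(j) < M · E_m(j')`; the cycle-2
shallow-point eliminants of `stub_nonImmersiveIntegral` need the same comparison with the factor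
`2` replaced by a general `D₀` subject to `D₀ (h+1) ≤ 2m+2`:

* upper bound `E_m(j) ≤ (h+1) (2m)^h M^h` (each of the `h + 1` terms is at most the top one,
  `ExpoCongruence.geom_sum_le`);
* lower bound `E_m(j') ≥ M^h` (the top term alone, `ExpoCongruence.pow_le_geom_sum`);
* the numerical inequality `D₀ (h+1) (2m)^h ≤ (2m+2) (2m)^h < (2m+2) (2m+2)^h = M`, valid as
  soon as `1 ≤ h` (here `m ≥ 2` gives `⌊log₂ m⌋ ≥ 1`).

Everything is Mathlib-only natural-number arithmetic.
-/

-- layout Summits/ValiantsHypothesis/ValiantsHypothesis forces the duplicated namespace component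
set_option linter.dupNamespace false

namespace Summit.ValiantsHypothesis.ValiantsHypothesis.Theorems.BinomialCandidateStubs

open scoped BigOperators

namespace ExpoCongruenceDeg

/-- The numerical heart with a general factor: `D (h+1) c^h < (c+2)^{h+1}` as soon as `1 ≤ h` and
`D (h+1) ≤ c + 2`. -/
theorem mul_succ_mul_pow_lt (D c h : ℕ) (hh : 1 ≤ h) (hD : D * (h + 1) ≤ c + 2) :
    D * ((h + 1) * c ^ h) < (c + 2) ^ (h + 1) := by
  have h2 : c ^ h < (c + 2) ^ h := Nat.pow_lt_pow_left (by omega) (by omega)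
  calc D * ((h + 1) * c ^ h) = (D * (h + 1)) * c ^ h := by ring
    _ ≤ (c + 2) * c ^ h := Nat.mul_le_mul_right _ hD
    _ < (c + 2) * (c + 2) ^ h := Nat.mul_lt_mul_of_pos_left h2 (by omega)
    _ = (c + 2) ^ (h + 1) := by rw [pow_succ']

/-- The comparison `D E(j) < M E(j')` for geometric sums with ratios `j M`, `j' M`, given the
numerical inequality `D (h+1) c^h < M` for a common bound `c` of the `j`'s. -/
theorem mul_geom_sum_lt (D M h c j j' : ℕ) (hM : 1 ≤ M) (hj1 : 1 ≤ j) (hj : j ≤ c)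
    (hj' : 1 ≤ j') (hkey : D * ((h + 1) * c ^ h) < M) :
    D * ∑ k ∈ Finset.range (h + 1), (j * M) ^ k <
      M * ∑ k ∈ Finset.range (h + 1), (j' * M) ^ k := by
  have hup : ∑ k ∈ Finset.range (h + 1), (j * M) ^ k ≤ (h + 1) * (c ^ h * M ^ h) :=
    calc ∑ k ∈ Finset.range (h + 1), (j * M) ^ k ≤ (h + 1) * (j * M) ^ h :=
          ExpoCongruence.geom_sum_le _ _
            (Nat.one_le_iff_ne_zero.mpr (Nat.mul_ne_zero (by omega) (by omega)))
      _ ≤ (h + 1) * (c * M) ^ h :=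
          Nat.mul_le_mul_left _ (Nat.pow_le_pow_left (Nat.mul_le_mul_right _ hj) h)
      _ = (h + 1) * (c ^ h * M ^ h) := by rw [mul_pow]
  have hlow : M ^ h ≤ ∑ k ∈ Finset.range (h + 1), (j' * M) ^ k :=
    le_trans (Nat.pow_le_pow_left (Nat.le_mul_of_pos_left M hj') h)
      (ExpoCongruence.pow_le_geom_sum _ _)
  calc D * ∑ k ∈ Finset.range (h + 1), (j * M) ^ k ≤ D * ((h + 1) * (c ^ h * M ^ h)) :=
        Nat.mul_le_mul_left D hup
    _ = D * ((h + 1) * c ^ h) * M ^ h := by ring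
    _ < M * M ^ h := Nat.mul_lt_mul_of_pos_right hkey (pow_pos (by omega) h)
    _ ≤ M * ∑ k ∈ Finset.range (h + 1), (j' * M) ^ k := Nat.mul_le_mul_left M hlow

end ExpoCongruenceDeg

/-- **Helper `expoCongruence_deg`** (line `registered`, crux `BinomialElusive.BinomialCandidate`;
generalises `stub_expoCongruence`): for `m ≥ 2`, `1 ≤ j, j' ≤ 2m` and any `D₀` with
`D₀ (h+1) ≤ 2m+2`, where `h = ⌊log₂ m⌋²` and `M = (2m+2)^{h+1}`, the exponents
`E_m(j) = Σ_{k ≤ h} (jM)^k` satisfy `D₀ · E_m(j) < M · E_m(j')`. -/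
theorem expoCongruence_deg :
    ∀ m ≥ 2, ∀ D₀ j j' : ℕ, D₀ * (Nat.log 2 m ^ 2 + 1) ≤ 2 * m + 2 → 1 ≤ j → j ≤ 2 * m →
      1 ≤ j' → j' ≤ 2 * m →
      D₀ * (∑ k ∈ Finset.range (Nat.log 2 m ^ 2 + 1),
          (j * (2 * m + 2) ^ (Nat.log 2 m ^ 2 + 1)) ^ k) <
        (2 * m + 2) ^ (Nat.log 2 m ^ 2 + 1) *
          (∑ k ∈ Finset.range (Nat.log 2 m ^ 2 + 1),
            (j' * (2 * m + 2) ^ (Nat.log 2 m ^ 2 + 1)) ^ k) := by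
  intro m hm D₀ j j' hD hj1 hj hj'1 _
  have hL : 1 ≤ Nat.log 2 m := Nat.le_log_of_pow_le (by norm_num) (by simpa using hm)
  set h := Nat.log 2 m ^ 2 with hh
  have hh1 : 1 ≤ h := Nat.one_le_pow _ _ (by omega)
  have hM : 1 ≤ (2 * m + 2) ^ (h + 1) := Nat.one_le_pow _ _ (by omega)
  exact ExpoCongruenceDeg.mul_geom_sum_lt D₀ _ h (2 * m) j j' hM hj1 hj hj'1
    (ExpoCongruenceDeg.mul_succ_mul_pow_lt D₀ (2 * m) h hh1 hD)

end Summit.ValiantsHypothesis.ValiantsHypothesis.Theorems.BinomialCandidateStubs
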